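import Mathlib.Topology.ContinuousMap.SecondCountableSpace
import Literature.Analysis.FluidPDE.SuitableWeak
import HarnessLib

/-!
# Time slices of weak spatial gradients

Analysis/FluidPDE support file (serves the decomposition of the ε-regularity criterion
`Literature.Analysis.FluidPDE.ckn_epsilon_regularity`, Caffarelli–Kohn–Nirenberg 1982, Prop. 2:
the interpolation, local-energy and pressure estimates of that decomposition are slice-wise
statements about `u(t, ·) ∈ W^{1,2}(B_r)`).

Let `E` be a finite-dimensional real inner product space with Lebesgue measure, `Ω ⊆ E` open and
`a < b`. The accepted space–time notion `Fluid.HasWeakSpatialGradientOn Q u G`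
(`FluidPDE/SuitableWeak`; Caffarelli–Kohn–Nirenberg 1982, (2.1): "`∇u ∈ L²` in the sense of
distributions on the space–time region") tests `u` against *space–time* test functions
`φ ∈ C_c^∞(Q)`, whereas the Sobolev theory of the tree (`FunctionSpaces/SobolevDomain`,
`Literature.Analysis.FunctionSpaces.HasWeakFDerivOn Ω μ f g`; Evans, *PDE*, §5.2.1) is about a
single function on `Ω`. This file proves the bridge used tacitly throughout the partial
regularity literature (e.g. Caffarelli–Kohn–Nirenberg 1982, §2, (2.8)–(2.10): the Sobolev
inequality is applied to `u(·, t)` on `B_r` "for almost every `t`"; Robinson–Rodrigo–Sadowski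
2016, Lemma 15.10, proof: "for almost every `s`, `u(s) ∈ H¹(B_r)`"):

* `HasWeakSpatialGradientOn.ae_hasWeakFDerivOn_slice`: if `G` is a weak spatial gradient of `u`
  on the product region `(a, b) × Ω`, then for a.e. `t ∈ (a, b)` the slice `G t` is a weak
  derivative of the slice `u t` on `Ω` in the sense of `HasWeakFDerivOn Ω volume (u t) (G t)`;
* `HasWeakSpatialGradientOn.ae_hasWeakFDerivOn_ball`: the case of a parabolic cylinder
  `Q_r(t, x) = (t - r², t) × B_r(x)`.

## Proof

(1) *Local integrability of the slices.* `Ω` is exhausted by compact sets `Kₘ` absorbing every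
compact subset of `Ω` (`exists_compact_exhaustion_absorbing`), `(a, b)` by compact intervals
`Jₙ`; `uncurry u` is integrable on the compact set `Jₙ × Kₘ ⊆ (a, b) × Ω`, so by Fubini
(`MeasureTheory.Integrable.prod_right_ae`) `u t` is integrable on `Kₘ` for a.e. `t ∈ Jₙ`; a
countable intersection gives local integrability of `u t` (and of `G t`) on `Ω` for a.e. `t`.
(2) *The identity for one test function.* For `ψ ∈ C_c^∞(Ω)` and directions `v, w`, testing the
space–time identity with `φ(t, x) = η(t) ψ(x)`, `η ∈ C_c^∞((a, b))`, gives
`∫ η(t) (A(t) + B(t)) dt = 0` with `A(t) = ∫ ∂_v ψ ⟪u(t), w⟫`, `B(t) = ∫ ψ ⟪G(t) v, w⟫`, both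
locally integrable on `(a, b)`; the fundamental lemma of the calculus of variations
(`IsOpen.ae_eq_zero_of_integral_contDiff_smul_eq_zero`) yields `A(t) = -B(t)` for a.e. `t`
(`HasWeakSpatialGradientOn.ae_slice_identity`).
(3) *Countably many test functions suffice.* For each `Kₘ` there is a countable family
`Dₘ ⊆ C_c^∞(Ω)` of functions supported in `Kₘ` such that every `ψ ∈ C_c^∞(Ω)` supported in `Kₘ`
is the uniform limit, together with its derivative, of a sequence in `Dₘ`
(`exists_countable_testFunctions_dense`: the map `ψ ↦ (ψ, Dψ)` takes values in the space
`C(E, ℝ × (E →L[ℝ] ℝ))` with the compact-open topology, which is second countable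
(`ContinuousMap.instSecondCountableTopology`), hence every subset is separable, and convergence
there is locally uniform convergence, which is uniform for functions supported in the fixed
compact `Kₘ`). The a.e. set of good times is then the countable intersection over `m`, `ψ ∈ Dₘ`
and basis directions `v = eᵢ`, `w = eⱼ`; at a good time the identity passes to arbitrary `ψ` by
dominated convergence and to arbitrary `v`, and to the vector-valued form of `HasWeakFDerivOn`,
by linearity (expansion in the orthonormal basis `stdOrthonormalBasis ℝ E`).

## Mathlib search

Mathlib (this pin) has no weak derivatives; used: `ContinuousMap.instSecondCountableTopology`,
`ContinuousMap.tendsto_iff_tendstoLocallyUniformly`, `mem_closure_iff_seq_limit`,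
`IsOpen.ae_eq_zero_of_integral_contDiff_smul_eq_zero`, `Integrable.prod_right_ae`,
`Integrable.integral_prod_left`, `tendsto_integral_of_dominated_convergence`. The tree's
`Literature.Analysis.FluidPDE.ae_integral_inner_gradient_eq_zero` (`SuitableWeakPressure`) is step (2) for the
divergence constraint; the converse direction (slices ⇒ space–time) is
`Literature.Analysis.FluidPDE.exists_stronglyMeasurable_of_sliced_weakGradient` (`LerayHopfSpatialGradient`).

## References

* L. Caffarelli, R. Kohn, L. Nirenberg, *Partial regularity of suitable weak solutions of the
  Navier–Stokes equations*, Comm. Pure Appl. Math. 35 (1982), 771–831, §2, (2.1), (2.8)–(2.10).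
* J. C. Robinson, J. L. Rodrigo, W. Sadowski, *The three-dimensional Navier–Stokes equations*,
  Cambridge Studies in Advanced Mathematics 157 (2016), Lemma 15.10 (proof).
* L. C. Evans, *Partial Differential Equations*, 2nd ed. (2010), §5.2.1 (weak derivatives),
  §5.9.2 (spaces involving time).
-/

noncomputable section

open MeasureTheory Set Function Filter Topology TopologicalSpace Metric
open scoped NNReal ENNReal InnerProductSpace RealInnerProductSpace

namespace Literature.Analysis.FluidPDE

/-! ### Compact exhaustions absorbing compact subsets -/

section Exhaustion

variable {X : Type*} [NormedAddCommGroup X] [NormedSpace ℝ X] [FiniteDimensional ℝ X]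

/-- An open subset `S` of a finite-dimensional real normed space has a countable family of compact
subsets `Kₙ ⊆ S` such that every compact subset of `S` is contained in some `Kₙ` (take
`Kₙ = {‖x‖ ≤ n} ∩ {infEdist(x, Sᶜ) ≥ 1/(n+1)}`; Evans, *PDE*, §5.2.1, the exhaustion used for
`L¹_loc(U)`). [folklore] -/
theorem exists_compact_exhaustion_absorbing (S : Opens X) :
    ∃ K : ℕ → Set X, (∀ n, IsCompact (K n)) ∧ (∀ n, K n ⊆ (S : Set X)) ∧
      ∀ k ⊆ (S : Set X), IsCompact k → ∃ n, k ⊆ K n := by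
  set K : ℕ → Set X := fun n => closedBall (0 : X) n ∩
    {x | ((n : ℝ≥0∞) + 1)⁻¹ ≤ Metric.infEDist x ((S : Set X)ᶜ)} with hK
  have hclosed : ∀ n, IsClosed (K n) := fun n =>
    isClosed_closedBall.inter (isClosed_le continuous_const Metric.continuous_infEDist)
  refine ⟨K, fun n => (isCompact_closedBall (0 : X) n).of_isClosed_subset (hclosed n)
    inter_subset_left, fun n x hx => ?_, fun k hkS hk => ?_⟩
  · -- `Kₙ ⊆ S`: positive distance to the closed set `Sᶜ`
    have hpos : 0 < Metric.infEDist x ((S : Set X)ᶜ) :=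
      lt_of_lt_of_le (ENNReal.inv_pos.2 (by simp)) hx.2
    have hx' : x ∉ closure ((S : Set X)ᶜ) := (Metric.infEDist_pos_iff_notMem_closure).1 hpos
    rw [S.isOpen.isClosed_compl.closure_eq] at hx'
    exact not_notMem.1 hx'
  · -- a compact `k ⊆ S` lies in some `Kₙ`
    rcases k.eq_empty_or_nonempty with rfl | hne
    · exact ⟨0, empty_subset _⟩
    obtain ⟨R, hR⟩ := hk.isBounded.subset_closedBall (0 : X)
    obtain ⟨x₀, hx₀k, hmin⟩ := hk.exists_isMinOn hne Metric.continuous_infEDist.continuousOn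
    have hpos : 0 < Metric.infEDist x₀ ((S : Set X)ᶜ) := by
      have hx' : x₀ ∉ closure ((S : Set X)ᶜ) := by
        rw [S.isOpen.isClosed_compl.closure_eq]; exact fun h => h (hkS hx₀k)
      exact (Metric.infEDist_pos_iff_notMem_closure).2 hx'
    obtain ⟨N, hN⟩ := ENNReal.exists_inv_nat_lt hpos.ne'
    obtain ⟨M, hM⟩ := exists_nat_ge R
    refine ⟨max N M, fun x hx => ⟨?_, ?_⟩⟩
    · have h1 : x ∈ closedBall (0 : X) R := hR hx
      rw [mem_closedBall] at h1 ⊢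
      exact h1.trans (hM.trans (by exact_mod_cast le_max_right N M))
    · have h2 : Metric.infEDist x₀ ((S : Set X)ᶜ) ≤ Metric.infEDist x ((S : Set X)ᶜ) := hmin hx
      refine le_trans ?_ (hN.le.trans h2)
      refine ENNReal.inv_le_inv.2 ?_
      calc (N : ℝ≥0∞) ≤ (max N M : ℕ) := by exact_mod_cast le_max_left N M
        _ ≤ ((max N M : ℕ) : ℝ≥0∞) + 1 := le_self_add

end Exhaustion

/-! ### A countable `C¹`-dense family of test functions -/

section Density

variable {X : Type*} [NormedAddCommGroup X] [NormedSpace ℝ X] [FiniteDimensional ℝ X]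

/-- **Countably many test functions control all of them.** For an open set `Ω` and a compact
`K`, there is a countable family `D` of test functions on `Ω` supported in `K` such that every
test function `ψ` on `Ω` supported in `K` is the uniform limit of a sequence in `D` whose
derivatives converge uniformly to `Dψ` (separability of the subspace
`{(ψ, Dψ)} ⊆ C(X, ℝ × (X →L[ℝ] ℝ))` for the compact-open topology, which is second countable;
locally uniform convergence is uniform for functions supported in `K`). [folklore] -/
theorem exists_countable_testFunctions_dense (Ω : Opens X) {K : Set X} (hK : IsCompact K) :
    ∃ D : Set (X → ℝ), D.Countable ∧
      (∀ ψ ∈ D, FunctionSpaces.IsTestFunctionOn Ω ψ ∧ tsupport ψ ⊆ K) ∧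
      ∀ ψ : X → ℝ, FunctionSpaces.IsTestFunctionOn Ω ψ → tsupport ψ ⊆ K →
        ∃ s : ℕ → X → ℝ, (∀ k, s k ∈ D) ∧ TendstoUniformly s ψ atTop ∧
          TendstoUniformly (fun k => fderiv ℝ (s k)) (fderiv ℝ ψ) atTop := by
  classical
  set T : Set (X → ℝ) := {ψ | FunctionSpaces.IsTestFunctionOn Ω ψ ∧ tsupport ψ ⊆ K} with hT
  have hJc : ∀ ψ ∈ T, Continuous (fun x => (ψ x, fderiv ℝ ψ x)) := fun ψ hψ =>
    hψ.1.contDiff.continuous.prodMk (hψ.1.contDiff.continuous_fderiv (by simp))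
  set S : Set C(X, ℝ × (X →L[ℝ] ℝ)) :=
    {F | ∃ ψ ∈ T, ⇑F = fun x => (ψ x, fderiv ℝ ψ x)} with hS
  have hsel : ∀ F : S, ∃ ψ ∈ T, ⇑(F : C(X, ℝ × (X →L[ℝ] ℝ))) = fun x => (ψ x, fderiv ℝ ψ x) :=
    fun F => F.2
  choose sel hselT hselF using hsel
  obtain ⟨d, hdc, hdd⟩ := TopologicalSpace.exists_countable_dense S
  refine ⟨sel '' d, hdc.image _, ?_, ?_⟩
  · rintro ψ ⟨F, -, rfl⟩
    exact hselT F
  · intro ψ hψ hψK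
    have hψT : ψ ∈ T := ⟨hψ, hψK⟩
    set Fψ : C(X, ℝ × (X →L[ℝ] ℝ)) := ⟨fun x => (ψ x, fderiv ℝ ψ x), hJc ψ hψT⟩ with hFψ
    have hFψS : Fψ ∈ S := ⟨ψ, hψT, rfl⟩
    have hcl : (⟨Fψ, hFψS⟩ : S) ∈ closure d := by
      rw [hdd.closure_eq]; exact mem_univ _
    obtain ⟨c, hcd, hclim⟩ := mem_closure_iff_seq_limit.1 hcl
    refine ⟨fun k => sel (c k), fun k => ⟨c k, hcd k, rfl⟩, ?_⟩
    -- convergence in `C(X, ℝ × (X →L[ℝ] ℝ))` is locally uniform convergence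
    have h1 : Tendsto (fun k => ((c k : S) : C(X, ℝ × (X →L[ℝ] ℝ)))) atTop (𝓝 Fψ) :=
      (continuous_subtype_val.tendsto _).comp hclim
    have h2 := ContinuousMap.tendsto_iff_tendstoLocallyUniformly.1 h1
    have h3 : TendstoUniformlyOn (fun k x => ((c k : S) : C(X, ℝ × (X →L[ℝ] ℝ))) x) Fψ atTop
        K := (tendstoLocallyUniformly_iff_forall_isCompact.1 h2) K hK
    have h4 : ∀ k x, ((c k : S) : C(X, ℝ × (X →L[ℝ] ℝ))) x =
        (sel (c k) x, fderiv ℝ (sel (c k)) x) := fun k x => congrFun (hselF (c k)) x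
    -- outside `K` all the functions and derivatives vanish, so the convergence is uniform
    have h5 : TendstoUniformly (fun k x => (sel (c k) x, fderiv ℝ (sel (c k)) x))
        (fun x => (ψ x, fderiv ℝ ψ x)) atTop := by
      rw [Metric.tendstoUniformly_iff]
      intro ε hε
      filter_upwards [(Metric.tendstoUniformlyOn_iff.1 h3) ε hε] with k hk x
      by_cases hx : x ∈ K
      · have := hk x hx
        rwa [h4 k x] at this
      · have hψ0 : ψ x = 0 := image_eq_zero_of_notMem_tsupport fun h' => hx (hψK h')
        have hψ1 : fderiv ℝ ψ x = 0 :=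
          fderiv_of_notMem_tsupport (𝕜 := ℝ) fun h' => hx (hψK h')
        have hs0 : sel (c k) x = 0 :=
          image_eq_zero_of_notMem_tsupport fun h' => hx ((hselT (c k)).2 h')
        have hs1 : fderiv ℝ (sel (c k)) x = 0 :=
          fderiv_of_notMem_tsupport (𝕜 := ℝ) fun h' => hx ((hselT (c k)).2 h')
        simp [hψ0, hψ1, hs0, hs1, hε]
    refine ⟨?_, ?_⟩
    · have := uniformContinuous_fst.comp_tendstoUniformly h5
      simpa only [Function.comp_def] using this
    · have := uniformContinuous_snd.comp_tendstoUniformly h5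
      simpa only [Function.comp_def] using this

end Density

/-! ### Slicing -/

section Slicing

variable {E : Type*} [NormedAddCommGroup E] [InnerProductSpace ℝ E] [FiniteDimensional ℝ E]
  [MeasurableSpace E] [BorelSpace E]

omit [FiniteDimensional ℝ E] [MeasurableSpace E] [BorelSpace E] in
/-- `η(t) ψ(x)` is a space–time test function on `(a, b) × Ω` when `η ∈ C_c^∞((a, b))` and
`ψ ∈ C_c^∞(Ω)`. [folklore] -/
theorem isSpaceTimeTestOn_mul {a b : ℝ} {Ω : Opens E} {η : ℝ → ℝ} {ψ : E → ℝ}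
    (hη : ContDiff ℝ (⊤ : ℕ∞) η) (hηc : HasCompactSupport η) (hηs : tsupport η ⊆ Ioo a b)
    (hψ : FunctionSpaces.IsTestFunctionOn Ω ψ) :
    IsSpaceTimeTestOn (⟨Ioo a b ×ˢ (Ω : Set E), isOpen_Ioo.prod Ω.isOpen⟩ : Opens (ℝ × E))
      (fun t x => η t * ψ x) where
  contDiff := by
    have : uncurry (fun t x => η t * ψ x) = fun z : ℝ × E => η z.1 * ψ z.2 := rfl
    rw [this]
    exact (hη.comp contDiff_fst).mul (hψ.contDiff.comp contDiff_snd)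
  hasCompactSupport := by
    have : uncurry (fun t x => η t * ψ x) = fun z : ℝ × E => η z.1 * ψ z.2 := rfl
    rw [this]
    refine HasCompactSupport.intro (hηc.prod hψ.hasCompactSupport) ?_
    rintro ⟨t, x⟩ hz
    rcases not_and_or.1 (fun h => hz (mem_prod.2 h)) with ht | hx
    · simp [image_eq_zero_of_notMem_tsupport ht]
    · simp [image_eq_zero_of_notMem_tsupport hx]
  tsupport_subset := by
    have : uncurry (fun t x => η t * ψ x) = fun z : ℝ × E => η z.1 * ψ z.2 := rfl
    rw [this]
    refine (closure_minimal ?_ ((isClosed_tsupport η).prod (isClosed_tsupport ψ))).trans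
      (prod_mono hηs hψ.tsupport_subset)
    rintro ⟨t, x⟩ hz
    rw [Function.mem_support] at hz
    exact ⟨subset_tsupport _ (left_ne_zero_of_mul hz), subset_tsupport _ (right_ne_zero_of_mul hz)⟩

/-- A scalar field `θ` on space–time which is continuous and vanishes off a compact subset `C`
of the open region `Q`, multiplied with `⟪u, w⟫` for a field `u` locally integrable on `Q`,
gives an integrable function on `ℝ × E`. [folklore] -/
theorem integrable_mul_inner_of_locallyIntegrableOn {Q : Opens (ℝ × E)} {u : ℝ → E → E}
    (hu : LocallyIntegrableOn (uncurry u) (Q : Set (ℝ × E)) volume) {θ : ℝ × E → ℝ}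
    (hθ : Continuous θ) {C : Set (ℝ × E)} (hC : IsCompact C) (hCQ : C ⊆ (Q : Set (ℝ × E)))
    (hθC : ∀ z ∉ C, θ z = 0) (w : E) :
    Integrable (fun z : ℝ × E => θ z * ⟪u z.1 z.2, w⟫) (volume : Measure (ℝ × E)) := by
  have huC : IntegrableOn (uncurry u) C volume := hu.integrableOn_compact_subset hCQ hC
  obtain ⟨M, hM⟩ := hθ.bounded_above_of_compact_support (HasCompactSupport.intro hC hθC)
  have hsupp : support (fun z : ℝ × E => θ z * ⟪u z.1 z.2, w⟫) ⊆ C := by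
    intro z hz
    by_contra hzC
    exact hz (by simp [hθC z hzC])
  refine (integrableOn_iff_integrable_of_support_subset hsupp).1 ?_
  refine Integrable.mono' ((huC.norm.mul_const (M * ‖w‖)))
    (hθ.aestronglyMeasurable.mul (huC.aestronglyMeasurable.inner aestronglyMeasurable_const)) ?_
  filter_upwards with z
  rw [norm_mul]
  calc ‖θ z‖ * ‖⟪u z.1 z.2, w⟫‖ ≤ M * (‖u z.1 z.2‖ * ‖w‖) :=
        mul_le_mul (hM z) (norm_inner_le_norm _ _) (norm_nonneg _) ((norm_nonneg _).trans (hM z))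
    _ = ‖uncurry u z‖ * (M * ‖w‖) := by simp [uncurry]; ring

/-- The same for the gradient field: `θ ⟪G v, w⟫` is integrable on `ℝ × E`. [folklore] -/
theorem integrable_mul_inner_apply_of_locallyIntegrableOn {Q : Opens (ℝ × E)}
    {G : ℝ → E → E →L[ℝ] E}
    (hG : LocallyIntegrableOn (uncurry G) (Q : Set (ℝ × E)) volume) {θ : ℝ × E → ℝ}
    (hθ : Continuous θ) {C : Set (ℝ × E)} (hC : IsCompact C) (hCQ : C ⊆ (Q : Set (ℝ × E)))
    (hθC : ∀ z ∉ C, θ z = 0) (v w : E) :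
    Integrable (fun z : ℝ × E => θ z * ⟪G z.1 z.2 v, w⟫) (volume : Measure (ℝ × E)) := by
  have hGC : IntegrableOn (uncurry G) C volume := hG.integrableOn_compact_subset hCQ hC
  obtain ⟨M, hM⟩ := hθ.bounded_above_of_compact_support (HasCompactSupport.intro hC hθC)
  have hsupp : support (fun z : ℝ × E => θ z * ⟪G z.1 z.2 v, w⟫) ⊆ C := by
    intro z hz
    by_contra hzC
    exact hz (by simp [hθC z hzC])
  refine (integrableOn_iff_integrable_of_support_subset hsupp).1 ?_
  have hmeas : AEStronglyMeasurable (fun z : ℝ × E => G z.1 z.2 v) (volume.restrict C) :=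
    (ContinuousLinearMap.apply ℝ E v).continuous.comp_aestronglyMeasurable hGC.aestronglyMeasurable
  refine Integrable.mono' ((hGC.norm.mul_const (M * (‖v‖ * ‖w‖))))
    (hθ.aestronglyMeasurable.mul (hmeas.inner aestronglyMeasurable_const)) ?_
  filter_upwards with z
  rw [norm_mul]
  calc ‖θ z‖ * ‖⟪G z.1 z.2 v, w⟫‖ ≤ M * (‖G z.1 z.2‖ * ‖v‖ * ‖w‖) := by
        refine mul_le_mul (hM z) ?_ (norm_nonneg _) ((norm_nonneg _).trans (hM z))
        exact (norm_inner_le_norm _ _).trans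
          (mul_le_mul_of_nonneg_right (ContinuousLinearMap.le_opNorm _ _) (norm_nonneg _))
    _ = ‖uncurry G z‖ * (M * (‖v‖ * ‖w‖)) := by simp [uncurry]; ring

variable {a b : ℝ} {Ω : Opens E} {u : ℝ → E → E} {G : ℝ → E → E →L[ℝ] E}

/-- For a compact time set `J ⊆ (a, b)` and `ψ ∈ C_c^∞(Ω)`, the integrand
`(t, x) ↦ ∂_v ψ(x) ⟪u(t, x), w⟫` is integrable on `J × E`. [folklore] -/
theorem HasWeakSpatialGradientOn.integrable_fderiv_mul_inner_prod
    (h : HasWeakSpatialGradientOn (⟨Ioo a b ×ˢ (Ω : Set E), isOpen_Ioo.prod Ω.isOpen⟩ : Opens (ℝ × E)) u G) {ψ : E → ℝ}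
    (hψ : FunctionSpaces.IsTestFunctionOn Ω ψ) (v w : E) {J : Set ℝ} (hJ : J ⊆ Ioo a b)
    (hJc : IsCompact J) :
    Integrable (fun z : ℝ × E => fderiv ℝ ψ z.2 v * ⟪u z.1 z.2, w⟫)
      ((volume.restrict J).prod (volume : Measure E)) := by
  have hC : IsCompact (J ×ˢ tsupport ψ) := hJc.prod hψ.hasCompactSupport
  have hCQ : J ×ˢ tsupport ψ ⊆ Ioo a b ×ˢ (Ω : Set E) :=
    prod_mono hJ hψ.tsupport_subset
  have huC : IntegrableOn (uncurry u) (J ×ˢ tsupport ψ) volume :=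
    h.locallyIntegrableOn.integrableOn_compact_subset hCQ hC
  have hθ : Continuous fun z : ℝ × E => fderiv ℝ ψ z.2 v :=
    ((hψ.contDiff.continuous_fderiv (by simp)).clm_apply continuous_const).comp continuous_snd
  have h1 : IntegrableOn (fun z : ℝ × E => fderiv ℝ ψ z.2 v * ⟪u z.1 z.2, w⟫)
      (J ×ˢ tsupport ψ) volume :=
    IntegrableOn.continuousOn_mul hθ.continuousOn (huC.inner_const w) hC
  have h2 : IntegrableOn (fun z : ℝ × E => fderiv ℝ ψ z.2 v * ⟪u z.1 z.2, w⟫)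
      (J ×ˢ (univ : Set E)) volume := by
    refine h1.of_forall_sdiff_eq_zero (hJc.measurableSet.prod MeasurableSet.univ) ?_
    rintro ⟨t, x⟩ ⟨htx, hz⟩
    have hx : x ∉ tsupport ψ := fun hx => hz ⟨(mem_prod.1 htx).1, hx⟩
    simp [fderiv_of_notMem_tsupport (𝕜 := ℝ) hx]
  rw [Measure.restrict_prod_eq_prod_univ J]
  exact h2

/-- For a compact time set `J ⊆ (a, b)` and `ψ ∈ C_c^∞(Ω)`, the integrand
`(t, x) ↦ ψ(x) ⟪G(t, x) v, w⟫` is integrable on `J × E`. [folklore] -/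
theorem HasWeakSpatialGradientOn.integrable_mul_inner_apply_prod
    (h : HasWeakSpatialGradientOn (⟨Ioo a b ×ˢ (Ω : Set E), isOpen_Ioo.prod Ω.isOpen⟩ : Opens (ℝ × E)) u G) {ψ : E → ℝ}
    (hψ : FunctionSpaces.IsTestFunctionOn Ω ψ) (v w : E) {J : Set ℝ} (hJ : J ⊆ Ioo a b)
    (hJc : IsCompact J) :
    Integrable (fun z : ℝ × E => ψ z.2 * ⟪G z.1 z.2 v, w⟫)
      ((volume.restrict J).prod (volume : Measure E)) := by
  have hC : IsCompact (J ×ˢ tsupport ψ) := hJc.prod hψ.hasCompactSupport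
  have hCQ : J ×ˢ tsupport ψ ⊆ Ioo a b ×ˢ (Ω : Set E) :=
    prod_mono hJ hψ.tsupport_subset
  have hGC : IntegrableOn (uncurry G) (J ×ˢ tsupport ψ) volume :=
    h.locallyIntegrableOn_grad.integrableOn_compact_subset hCQ hC
  have hGv : IntegrableOn (fun z : ℝ × E => G z.1 z.2 v) (J ×ˢ tsupport ψ) volume :=
    (ContinuousLinearMap.apply ℝ E v).integrable_comp hGC
  have hθ : Continuous fun z : ℝ × E => ψ z.2 := hψ.contDiff.continuous.comp continuous_snd
  have h1 : IntegrableOn (fun z : ℝ × E => ψ z.2 * ⟪G z.1 z.2 v, w⟫)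
      (J ×ˢ tsupport ψ) volume :=
    IntegrableOn.continuousOn_mul hθ.continuousOn (hGv.inner_const w) hC
  have h2 : IntegrableOn (fun z : ℝ × E => ψ z.2 * ⟪G z.1 z.2 v, w⟫)
      (J ×ˢ (univ : Set E)) volume := by
    refine h1.of_forall_sdiff_eq_zero (hJc.measurableSet.prod MeasurableSet.univ) ?_
    rintro ⟨t, x⟩ ⟨htx, hz⟩
    have hx : x ∉ tsupport ψ := fun hx => hz ⟨(mem_prod.1 htx).1, hx⟩
    simp [image_eq_zero_of_notMem_tsupport hx]
  rw [Measure.restrict_prod_eq_prod_univ J]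
  exact h2

/-- **The slice identity for one test function** (step (2) of the file docstring). If `G` is a
weak spatial gradient of `u` on `(a, b) × Ω`, then for every `ψ ∈ C_c^∞(Ω)` and all `v, w`,
`∫ ∂_v ψ ⟪u(t), w⟫ dx = -∫ ψ ⟪G(t) v, w⟫ dx` for a.e. `t ∈ (a, b)` (test with `η(t) ψ(x)`,
`η ∈ C_c^∞((a, b))`, and apply the fundamental lemma of the calculus of variations in `t`;
Caffarelli–Kohn–Nirenberg 1982, §2). [cite: CaffarelliKohnNirenberg1982, §2 (2.1)] -/
theorem HasWeakSpatialGradientOn.ae_slice_identity (h : HasWeakSpatialGradientOn (⟨Ioo a b ×ˢ (Ω : Set E), isOpen_Ioo.prod Ω.isOpen⟩ : Opens (ℝ × E)) u G)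
    {ψ : E → ℝ} (hψ : FunctionSpaces.IsTestFunctionOn Ω ψ) (v w : E) :
    ∀ᵐ t ∂(volume.restrict (Ioo a b)),
      ∫ x, fderiv ℝ ψ x v * ⟪u t x, w⟫ = -∫ x, ψ x * ⟪G t x v, w⟫ := by
  set A : ℝ → ℝ := fun t => ∫ x, fderiv ℝ ψ x v * ⟪u t x, w⟫ with hA
  set B : ℝ → ℝ := fun t => ∫ x, ψ x * ⟪G t x v, w⟫ with hB
  -- `A` and `B` are locally integrable on `(a, b)` (Fubini on `J × E`)
  have hlocA : LocallyIntegrableOn A (Ioo a b) volume := by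
    refine (locallyIntegrableOn_iff isOpen_Ioo.isLocallyClosed).2 fun J hJ hJc => ?_
    exact (h.integrable_fderiv_mul_inner_prod hψ v w hJ hJc).integral_prod_left
  have hlocB : LocallyIntegrableOn B (Ioo a b) volume := by
    refine (locallyIntegrableOn_iff isOpen_Ioo.isLocallyClosed).2 fun J hJ hJc => ?_
    exact (h.integrable_mul_inner_apply_prod hψ v w hJ hJc).integral_prod_left
  -- the fundamental lemma of the calculus of variations in `t`
  have hkey : ∀ᵐ t ∂(volume : Measure ℝ), t ∈ Ioo a b → (A + B) t = 0 := by
    refine isOpen_Ioo.ae_eq_zero_of_integral_contDiff_smul_eq_zero (hlocA.add hlocB) ?_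
    intro η hη hηc hηs
    have hφ : IsSpaceTimeTestOn (⟨Ioo a b ×ˢ (Ω : Set E), isOpen_Ioo.prod Ω.isOpen⟩ : Opens (ℝ × E))
        (fun t x => η t * ψ x) :=
      isSpaceTimeTestOn_mul hη hηc hηs hψ
    have hid := h.integral_fderiv_mul_inner_eq _ hφ v w
    have hderiv : ∀ t x, fderiv ℝ (fun x => η t * ψ x) x v = η t * fderiv ℝ ψ x v := by
      intro t x
      have hd : DifferentiableAt ℝ ψ x :=
        (hψ.contDiff.differentiable (by simp)).differentiableAt
      rw [fderiv_const_mul hd]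
      rfl
    simp_rw [hderiv] at hid
    have hl : ∀ t, ∫ x, η t * fderiv ℝ ψ x v * ⟪u t x, w⟫ = η t * A t := by
      intro t; rw [hA, ← integral_const_mul]; congr 1; funext x; ring
    have hr : ∀ t, ∫ x, η t * ψ x * ⟪G t x v, w⟫ = η t * B t := by
      intro t; rw [hB, ← integral_const_mul]; congr 1; funext x; ring
    simp_rw [hl, hr] at hid
    -- integrability of `η A` and `η B` on `ℝ` (Fubini on `tsupport η × E`)
    have hηc' : Continuous η := hη.continuous
    obtain ⟨M, hM⟩ := hηc'.bounded_above_of_compact_support hηc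
    have hηA : Integrable (fun t => η t * A t) (volume : Measure ℝ) := by
      have h1 := (h.integrable_fderiv_mul_inner_prod hψ v w hηs hηc).integral_prod_left
      have h2 : IntegrableOn (fun t => η t * A t) (tsupport η) volume :=
        IntegrableOn.continuousOn_mul hηc'.continuousOn h1 hηc
      refine (integrableOn_iff_integrable_of_support_subset ?_).1 h2
      intro t ht
      exact subset_tsupport _ (left_ne_zero_of_mul (Function.mem_support.1 ht))
    have hηB : Integrable (fun t => η t * B t) (volume : Measure ℝ) := by
      have h1 := (h.integrable_mul_inner_apply_prod hψ v w hηs hηc).integral_prod_left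
      have h2 : IntegrableOn (fun t => η t * B t) (tsupport η) volume :=
        IntegrableOn.continuousOn_mul hηc'.continuousOn h1 hηc
      refine (integrableOn_iff_integrable_of_support_subset ?_).1 h2
      intro t ht
      exact subset_tsupport _ (left_ne_zero_of_mul (Function.mem_support.1 ht))
    have : ∫ t, η t • (A + B) t = (∫ t, η t * A t) + ∫ t, η t * B t := by
      rw [← integral_add hηA hηB]
      congr 1; funext t; simp only [Pi.add_apply, smul_eq_mul]; ring
    rw [this, hid]
    ring
  -- conclusion
  rw [ae_restrict_iff' measurableSet_Ioo]
  filter_upwards [hkey] with t ht htI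
  have := ht htI
  simp only [Pi.add_apply] at this
  linarith

/-- Integrals of `cₖ F` converge to the integral of `c F` when `cₖ → c` uniformly, all these
continuous functions vanish off a fixed compact set `K`, and `F` is integrable on `K`
(dominated convergence). [folklore] -/
theorem tendsto_integral_mul_of_tendstoUniformly {K : Set E} (hK : IsCompact K) {F : E → ℝ}
    (hF : IntegrableOn F K volume) {c : ℕ → E → ℝ} {c' : E → ℝ} (hc : ∀ k, Continuous (c k))
    (hc' : Continuous c') (hcK : ∀ k, ∀ x ∉ K, c k x = 0)
    (hlim : TendstoUniformly c c' atTop) :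
    Tendsto (fun k => ∫ x, c k x * F x) atTop (𝓝 (∫ x, c' x * F x)) := by
  -- `c'` vanishes off `K` as the pointwise limit of the `cₖ`
  have hc'K : ∀ x ∉ K, c' x = 0 := fun x hx =>
    tendsto_nhds_unique (hlim.tendsto_at x)
      (tendsto_const_nhds.congr fun k => (hcK k x hx).symm)
  obtain ⟨M, hM⟩ := hc'.bounded_above_of_compact_support (HasCompactSupport.intro hK hc'K)
  have hrepr : ∀ k, (fun x => c k x * F x) = K.indicator (fun x => c k x * F x) := by
    intro k; funext x
    by_cases hx : x ∈ K
    · rw [indicator_of_mem hx]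
    · rw [indicator_of_notMem hx, hcK k x hx, zero_mul]
  refine tendsto_integral_filter_of_dominated_convergence
    (K.indicator fun x => (M + 1) * ‖F x‖) ?_ ?_ ?_ ?_
  · refine Eventually.of_forall fun k => ?_
    rw [hrepr k, aestronglyMeasurable_indicator_iff hK.measurableSet]
    exact (hc k).aestronglyMeasurable.mul hF.aestronglyMeasurable
  · have h1 : ∀ᶠ k in atTop, ∀ x, dist (c' x) (c k x) < 1 :=
      (Metric.tendstoUniformly_iff.1 hlim) 1 one_pos
    filter_upwards [h1] with k hk
    refine Eventually.of_forall fun x => ?_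
    by_cases hx : x ∈ K
    · rw [indicator_of_mem hx, norm_mul]
      refine mul_le_mul_of_nonneg_right ?_ (norm_nonneg _)
      have := hk x
      rw [Real.dist_eq] at this
      calc ‖c k x‖ = |c' x - (c' x - c k x)| := by rw [sub_sub_cancel, Real.norm_eq_abs]
        _ ≤ |c' x| + |c' x - c k x| := abs_sub _ _
        _ ≤ M + 1 := add_le_add (by simpa [Real.norm_eq_abs] using hM x) this.le
    · rw [indicator_of_notMem hx, hcK k x hx, zero_mul, norm_zero]
  · have hb : IntegrableOn (fun x => (M + 1) * ‖F x‖) K volume := hF.norm.const_mul (M + 1)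
    exact hb.integrable_indicator hK.measurableSet
  · exact Eventually.of_forall fun x => (hlim.tendsto_at x).mul_const (F x)

/-- A continuous function `c` vanishing off a compact set `K`, multiplied with a function `F`
integrable on `K`, is integrable on the whole space. [folklore] -/
theorem integrable_mul_of_eq_zero_off_compact {K : Set E} (hK : IsCompact K) {c : E → ℝ}
    (hc : Continuous c) (hcK : ∀ x ∉ K, c x = 0) {F : E → ℝ} (hF : IntegrableOn F K volume) :
    Integrable (fun x => c x * F x) (volume : Measure E) := by
  have h1 : IntegrableOn (fun x => c x * F x) K volume :=
    IntegrableOn.continuousOn_mul hc.continuousOn hF hK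
  refine (integrableOn_iff_integrable_of_support_subset fun x hx => ?_).1 h1
  by_contra hxK
  exact (Function.mem_support.1 hx) (by rw [hcK x hxK, zero_mul])

/-- Vector-valued version of `integrable_mul_of_eq_zero_off_compact`. [folklore] -/
theorem integrable_smul_of_eq_zero_off_compact {K : Set E} (hK : IsCompact K) {c : E → ℝ}
    (hc : Continuous c) (hcK : ∀ x ∉ K, c x = 0) {F : E → E} (hF : IntegrableOn F K volume) :
    Integrable (fun x => c x • F x) (volume : Measure E) := by
  have h1 : IntegrableOn (fun x => c x • F x) K volume :=
    IntegrableOn.continuousOn_smul hF hc.continuousOn hK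
  refine (integrableOn_iff_integrable_of_support_subset fun x hx => ?_).1 h1
  by_contra hxK
  exact (Function.mem_support.1 hx) (by rw [hcK x hxK, zero_smul])

omit [FiniteDimensional ℝ E] [MeasurableSpace E] [BorelSpace E] in
/-- Expansion of a continuous linear map along an orthonormal basis:
`L v = ∑ᵢ ⟪bᵢ, v⟫ L bᵢ`. [folklore] -/
theorem clm_apply_eq_sum_basis {ι : Type*} [Fintype ι] (b : OrthonormalBasis ι ℝ E)
    {F' : Type*} [NormedAddCommGroup F'] [NormedSpace ℝ F'] (L : E →L[ℝ] F') (v : E) :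
    L v = ∑ i, ⟪b i, v⟫ • L (b i) := by
  conv_lhs => rw [← b.sum_repr' v]
  simp [map_sum, map_smul]

omit [BorelSpace E] in
/-- Two integrable vector fields with the same components along an orthonormal basis have the
same integral. [folklore] -/
theorem integral_eq_of_integral_inner_basis_eq {ι : Type*} [Fintype ι] (b : OrthonormalBasis ι ℝ E)
    {μ : Measure E} {F₁ F₂ : E → E} (h₁ : Integrable F₁ μ) (h₂ : Integrable F₂ μ)
    (h : ∀ j, ∫ x, ⟪F₁ x, b j⟫ ∂μ = ∫ x, ⟪F₂ x, b j⟫ ∂μ) :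
    ∫ x, F₁ x ∂μ = ∫ x, F₂ x ∂μ := by
  have key : ∀ j, ⟪b j, ∫ x, F₁ x ∂μ⟫ = ⟪b j, ∫ x, F₂ x ∂μ⟫ := by
    intro j
    rw [← integral_inner h₁, ← integral_inner h₂]
    simp_rw [real_inner_comm (F₁ _) (b j), real_inner_comm (F₂ _) (b j)]
    exact h j
  calc ∫ x, F₁ x ∂μ = ∑ j, ⟪b j, ∫ x, F₁ x ∂μ⟫ • b j := (b.sum_repr' _).symm
    _ = ∑ j, ⟪b j, ∫ x, F₂ x ∂μ⟫ • b j := by simp_rw [key]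
    _ = ∫ x, F₂ x ∂μ := b.sum_repr' _

/-- **Time slices of a weak spatial gradient are weak derivatives of the slices.** If `G` is a
weak spatial gradient of the time-dependent field `u` on the product region `(a, b) × Ω`
(accepted `Fluid.HasWeakSpatialGradientOn`; Caffarelli–Kohn–Nirenberg 1982, (2.1)), then for
a.e. `t ∈ (a, b)` the slice `G t` is a weak derivative of `u t` on `Ω` in the sense of the
accepted `Literature.Analysis.FunctionSpaces.HasWeakFDerivOn Ω volume (u t) (G t)` (Evans,
*PDE*, §5.2.1): the form in which "`u(·, t) ∈ W^{1,1}_{loc}` for a.e. `t`" is used in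
Caffarelli–Kohn–Nirenberg 1982, §2 ((2.8)–(2.10)) and Robinson–Rodrigo–Sadowski 2016,
Lemma 15.10. See the file docstring for the proof. [cite: CaffarelliKohnNirenberg1982, §2 (2.1), (2.8)–(2.10)] -/
theorem HasWeakSpatialGradientOn.ae_hasWeakFDerivOn_slice
    (h : HasWeakSpatialGradientOn (⟨Ioo a b ×ˢ (Ω : Set E), isOpen_Ioo.prod Ω.isOpen⟩ : Opens (ℝ × E)) u G) :
    ∀ᵐ t ∂(volume.restrict (Ioo a b)), FunctionSpaces.HasWeakFDerivOn Ω volume (u t) (G t) := by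
  classical
  -- exhaustions of `Ω` and of `(a, b)`
  obtain ⟨K, hKc, hKΩ, hKabs⟩ := exists_compact_exhaustion_absorbing Ω
  set J : ℕ → Set ℝ := fun n => Icc (a + 1 / ((n : ℝ) + 1)) (b - 1 / ((n : ℝ) + 1)) with hJ
  have hJsub : ∀ n, J n ⊆ Ioo a b := by
    intro n t ht
    have hpos : (0 : ℝ) < 1 / ((n : ℝ) + 1) := Nat.one_div_pos_of_nat
    exact ⟨lt_of_lt_of_le (by linarith) ht.1, lt_of_le_of_lt ht.2 (by linarith)⟩
  have hJU : (⋃ n, J n) = Ioo a b := by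
    refine subset_antisymm (iUnion_subset hJsub) fun t ht => ?_
    obtain ⟨n, hn⟩ := exists_nat_one_div_lt (lt_min (sub_pos.2 ht.1) (sub_pos.2 ht.2))
    have h1 := min_le_left (t - a) (b - t)
    have h2 := min_le_right (t - a) (b - t)
    exact mem_iUnion.2 ⟨n, ⟨by linarith, by linarith⟩⟩
  -- (1) integrability of the slices on the `Kₘ`
  have hint : ∀ᵐ t ∂(volume.restrict (Ioo a b)), ∀ m,
      IntegrableOn (u t) (K m) volume ∧ IntegrableOn (G t) (K m) volume := by
    rw [← hJU, ae_restrict_iUnion_iff]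
    intro n
    refine ae_all_iff.2 fun m => ?_
    have hC : IsCompact (J n ×ˢ K m) := isCompact_Icc.prod (hKc m)
    have hCQ : J n ×ˢ K m ⊆ Ioo a b ×ˢ (Ω : Set E) :=
      prod_mono (hJsub n) (hKΩ m)
    have hu := h.locallyIntegrableOn.integrableOn_compact_subset hCQ hC
    have hG := h.locallyIntegrableOn_grad.integrableOn_compact_subset hCQ hC
    rw [IntegrableOn, Measure.volume_eq_prod, ← Measure.prod_restrict] at hu hG
    filter_upwards [hu.prod_right_ae, hG.prod_right_ae] with t htu htG
    exact ⟨htu, htG⟩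
  -- (3) countable dense families of test functions supported in the `Kₘ`
  have hD := fun m => exists_countable_testFunctions_dense Ω (hKc m)
  choose D hDc hDT hDd using hD
  set e := stdOrthonormalBasis ℝ E with he
  have hid : ∀ᵐ t ∂(volume.restrict (Ioo a b)), ∀ m, ∀ ψ ∈ D m, ∀ i j,
      ∫ x, fderiv ℝ ψ x (e i) * ⟪u t x, e j⟫ = -∫ x, ψ x * ⟪G t x (e i), e j⟫ := by
    refine ae_all_iff.2 fun m => ?_
    refine (ae_ball_iff (hDc m)).2 fun ψ hψ => ?_
    refine ae_all_iff.2 fun i => ae_all_iff.2 fun j => ?_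
    exact h.ae_slice_identity (hDT m ψ hψ).1 (e i) (e j)
  filter_upwards [hint, hid] with t hint hid
  -- local integrability of the slices at the good time `t`
  have hlocu : LocallyIntegrableOn (u t) (Ω : Set E) volume :=
    (locallyIntegrableOn_iff Ω.isOpen.isLocallyClosed).2 fun k hk hkc => by
      obtain ⟨m, hm⟩ := hKabs k hk hkc
      exact (hint m).1.mono_set hm
  have hlocG : LocallyIntegrableOn (G t) (Ω : Set E) volume :=
    (locallyIntegrableOn_iff Ω.isOpen.isLocallyClosed).2 fun k hk hkc => by
      obtain ⟨m, hm⟩ := hKabs k hk hkc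
      exact (hint m).2.mono_set hm
  refine ⟨hlocu, hlocG, fun φ v hφ => ?_⟩
  -- the scalar identities for `φ` along basis directions, by density
  obtain ⟨m, hm⟩ := hKabs (tsupport φ) hφ.tsupport_subset hφ.hasCompactSupport
  obtain ⟨s, hsD, hs0, hs1⟩ := hDd m φ hφ hm
  have hsT : ∀ k, FunctionSpaces.IsTestFunctionOn Ω (s k) ∧ tsupport (s k) ⊆ K m :=
    fun k => hDT m (s k) (hsD k)
  have hφ0 : ∀ x ∉ K m, φ x = 0 := fun x hx => image_eq_zero_of_notMem_tsupport fun h' => hx (hm h')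
  have hφ1 : ∀ x ∉ K m, fderiv ℝ φ x = 0 := fun x hx =>
    fderiv_of_notMem_tsupport (𝕜 := ℝ) fun h' => hx (hm h')
  have hs0' : ∀ k, ∀ x ∉ K m, s k x = 0 := fun k x hx =>
    image_eq_zero_of_notMem_tsupport fun h' => hx ((hsT k).2 h')
  have hs1' : ∀ k, ∀ x ∉ K m, fderiv ℝ (s k) x = 0 := fun k x hx =>
    fderiv_of_notMem_tsupport (𝕜 := ℝ) fun h' => hx ((hsT k).2 h')
  have hφc : Continuous φ := hφ.contDiff.continuous
  have hφd : Continuous (fderiv ℝ φ) := hφ.contDiff.continuous_fderiv (by simp)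
  have hsc : ∀ k, Continuous (s k) := fun k => (hsT k).1.contDiff.continuous
  have hsd : ∀ k, Continuous (fderiv ℝ (s k)) := fun k =>
    (hsT k).1.contDiff.continuous_fderiv (by simp)
  -- integrability of the slice data on `Kₘ`
  have hiu : ∀ j, IntegrableOn (fun x => ⟪u t x, e j⟫) (K m) volume := fun j =>
    (hint m).1.inner_const (e j)
  have hiG : ∀ i j, IntegrableOn (fun x => ⟪G t x (e i), e j⟫) (K m) volume := fun i j =>
    ((ContinuousLinearMap.apply ℝ E (e i)).integrable_comp (hint m).2).inner_const (e j)
  have hscalar : ∀ i j,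
      ∫ x, fderiv ℝ φ x (e i) * ⟪u t x, e j⟫ = -∫ x, φ x * ⟪G t x (e i), e j⟫ := by
    intro i j
    have hL : Tendsto (fun k => ∫ x, fderiv ℝ (s k) x (e i) * ⟪u t x, e j⟫) atTop
        (𝓝 (∫ x, fderiv ℝ φ x (e i) * ⟪u t x, e j⟫)) := by
      refine tendsto_integral_mul_of_tendstoUniformly (hKc m) (hiu j)
        (fun k => (hsd k).clm_apply continuous_const) (hφd.clm_apply continuous_const)
        (fun k x hx => by simp [hs1' k x hx]) ?_
      have := (ContinuousLinearMap.apply ℝ ℝ (e i)).uniformContinuous.comp_tendstoUniformly hs1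
      simpa only [Function.comp_def, ContinuousLinearMap.apply_apply] using this
    have hR : Tendsto (fun k => ∫ x, s k x * ⟪G t x (e i), e j⟫) atTop
        (𝓝 (∫ x, φ x * ⟪G t x (e i), e j⟫)) :=
      tendsto_integral_mul_of_tendstoUniformly (hKc m) (hiG i j) hsc hφc hs0' hs0
    have heq : ∀ k, ∫ x, fderiv ℝ (s k) x (e i) * ⟪u t x, e j⟫ =
        -∫ x, s k x * ⟪G t x (e i), e j⟫ := fun k => hid m (s k) (hsD k) i j
    refine tendsto_nhds_unique hL ?_
    simp_rw [heq]
    exact hR.neg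
  -- from the scalar identities to the vector identity of `HasWeakFDerivOn`
  have hzero1 : ∀ x, x ∉ (Ω : Set E) → (fderiv ℝ φ x v) • u t x = 0 := fun x hx => by
    simp [hφ1 x fun h' => hx (hKΩ m h')]
  have hzero2 : ∀ x, x ∉ (Ω : Set E) → φ x • G t x v = 0 := fun x hx => by
    rw [hφ0 x fun h' => hx (hKΩ m h'), zero_smul]
  rw [setIntegral_eq_integral_of_forall_compl_eq_zero hzero1,
    setIntegral_eq_integral_of_forall_compl_eq_zero hzero2, ← integral_neg]
  have hI1 : Integrable (fun x => (fderiv ℝ φ x v) • u t x) (volume : Measure E) :=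
    integrable_smul_of_eq_zero_off_compact (hKc m) (hφd.clm_apply continuous_const)
      (fun x hx => by simp [hφ1 x hx]) (hint m).1
  have hI2 : Integrable (fun x => -(φ x • G t x v)) (volume : Measure E) := by
    refine (integrable_smul_of_eq_zero_off_compact (hKc m) hφc hφ0 ?_).neg
    exact (ContinuousLinearMap.apply ℝ E v).integrable_comp (hint m).2
  refine integral_eq_of_integral_inner_basis_eq e hI1 hI2 fun j => ?_
  -- components: expand `v` along the basis and use the scalar identities
  have hiu' : ∀ i, Integrable (fun x => fderiv ℝ φ x (e i) * ⟪u t x, e j⟫) (volume : Measure E) :=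
    fun i => integrable_mul_of_eq_zero_off_compact (hKc m) (hφd.clm_apply continuous_const)
      (fun x hx => by simp [hφ1 x hx]) (hiu j)
  have hiG' : ∀ i, Integrable (fun x => φ x * ⟪G t x (e i), e j⟫) (volume : Measure E) :=
    fun i => integrable_mul_of_eq_zero_off_compact (hKc m) hφc hφ0 (hiG i j)
  calc ∫ x, ⟪(fderiv ℝ φ x v) • u t x, e j⟫
      = ∫ x, ∑ i, ⟪e i, v⟫ * (fderiv ℝ φ x (e i) * ⟪u t x, e j⟫) := by
        congr 1; funext x
        rw [real_inner_smul_left, clm_apply_eq_sum_basis e (fderiv ℝ φ x) v, Finset.sum_mul]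
        refine Finset.sum_congr rfl fun i _ => ?_
        rw [smul_eq_mul]; ring
    _ = ∑ i, ⟪e i, v⟫ * ∫ x, fderiv ℝ φ x (e i) * ⟪u t x, e j⟫ := by
        rw [integral_finsetSum _ fun i _ => (hiu' i).const_mul _]
        simp_rw [integral_const_mul]
    _ = ∑ i, ⟪e i, v⟫ * -∫ x, φ x * ⟪G t x (e i), e j⟫ := by simp_rw [hscalar]
    _ = -∫ x, ∑ i, ⟪e i, v⟫ * (φ x * ⟪G t x (e i), e j⟫) := by
        rw [integral_finsetSum _ fun i _ => (hiG' i).const_mul _, ← Finset.sum_neg_distrib]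
        simp_rw [integral_const_mul, mul_neg]
    _ = ∫ x, ⟪-(φ x • G t x v), e j⟫ := by
        rw [← integral_neg]
        congr 1; funext x
        rw [inner_neg_left, real_inner_smul_left, clm_apply_eq_sum_basis e (G t x) v, sum_inner,
          Finset.mul_sum]
        refine congrArg Neg.neg (Finset.sum_congr rfl fun i _ => ?_)
        rw [real_inner_smul_left]; ring

/-- **Slices of a weak spatial gradient on a parabolic cylinder.** If `G` is a weak spatial
gradient of `u` on `Q_r(t, x) = (t - r², t) × B_r(x)`, then for a.e. `s ∈ (t - r², t)`,
`G s` is a weak derivative of `u s` on the ball `B_r(x)` (Caffarelli–Kohn–Nirenberg 1982, §2;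
Robinson–Rodrigo–Sadowski 2016, Lemma 15.10: "for almost every `s`, `u(s) ∈ H¹(B_r)`"). [cite: CaffarelliKohnNirenberg1982, §2 (2.1), (2.8)–(2.10)] -/
theorem HasWeakSpatialGradientOn.ae_hasWeakFDerivOn_ball {r : ℝ} {z : ℝ × E}
    (h : HasWeakSpatialGradientOn (parabolicCylinderOpens r z) u G) :
    ∀ᵐ s ∂(volume.restrict (Ioo (z.1 - r ^ 2) z.1)),
      FunctionSpaces.HasWeakFDerivOn (⟨ball z.2 r, isOpen_ball⟩ : Opens E) volume (u s) (G s) :=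
  HasWeakSpatialGradientOn.ae_hasWeakFDerivOn_slice (Ω := (⟨ball z.2 r, isOpen_ball⟩ : Opens E)) h

end Slicing

end Literature.Analysis.FluidPDE
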